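import Mathlib
import HarnessLib
import Summits.HubbardSuperconductivity.HubbardSuperconductivity.Theorems.KLProgrammeCooperChannelRiccatiFlowDefs

/-!
# Route `KLProgramme`, crux K3 `KLRegimeTwoPointLimit` — the cubic ladder tails of a REPULSIVE Cooper block are summable to `O(A²)`
# (DECOMP App. E, Lemma E.4: «the cubic terms are summed with the DECAYING block envelopes — Σ_j ‖V_j^{A1g}‖³ ≤ C U², not (KU)³·c/U²»;
# HOME/p1/E5-NOTE.md §4; cell gate-hubbard-kl, seat p1 = C1 `BetaSplit` lead)

In the coupling induction (Lemma E.4) the scale-`k` increment of a repulsive `D₄` block of the Cooper vertex is the one-loop cascade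
step plus the FACTORISED cubic tail `V P V P V (1 + P V)⁻¹` (p416850 `cascade_eq_riccati_add`), of size `≲ b_k x_k³` with `b_k ≥ 0` the
scale-`k` bubble mass and `x_k` the block's form top, which follows the repulsive envelope `x_k ≤ A / (1 + A B_k)`,
`B_k = Σ_{j<k} b_j` (p3's `repulsiveEnvelope`, `repulsive_upper_envelope`).  A sign-blind bound `x_k ≤ K U` would give
`Σ_k b_k x_k³ ≲ (KU)³ Σ_k b_k ≍ (KU)³ · c/U² ≫ U`; the envelope gives the summable bound of this file:

* `sum_mul_repulsiveEnvelope_succ_cube_le` — `Σ_{k<N} b_k (A/(1 + A B_{k+1}))³ ≤ A²/2` for all `N` (exact telescoping against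
  `A²/(2(1 + A B_k)²)`: the discrete form of `∫ A³ dB/(1+AB)³ = A²/2`);
* `sum_mul_repulsiveEnvelope_cube_le` — with the envelope taken BEFORE the step, `Σ_{k<N} b_k (A/(1 + A B_k))³ ≤ (1 + β)³ A²/2`
  whenever `A b_k ≤ β` (one step changes the envelope by at most the factor `1 + A b_k`).

With `A = V₀^Γ ≍ U` and `b_k = O(1)`: the cubic tails of the repulsive blocks total `O(U²)` over ALL scales, uniformly in the infrared
cutoff — the `C U²` slack of Lemma E.4's envelopes.  Pure real analysis; no operators.
-/

noncomputable section

namespace Summit.HubbardSuperconductivity.HubbardSuperconductivity.Theorems.CooperChannelCubicTail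

set_option linter.dupNamespace false -- summit = problem name (single-conjunct summit), D-0017

open Finset
open Summit.HubbardSuperconductivity.HubbardSuperconductivity.Theorems.CooperChannelRiccatiFlow (repulsiveEnvelope)

/-- The one-step telescoping inequality: for `1 ≤ u`, `v = u + A b`, `A, b ≥ 0`:
`b (A / v)³ ≤ A²/(2u²) − A²/(2v²)` (indeed the difference is `A²(v−u)²(v+2u)/(2u²v³) ≥ 0`). -/
theorem step_telescope {A b u v : ℝ} (hA : 0 ≤ A) (hb : 0 ≤ b) (hu : 1 ≤ u) (hv : v = u + A * b) :
    b * (A / v) ^ 3 ≤ A ^ 2 / (2 * u ^ 2) - A ^ 2 / (2 * v ^ 2) := by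
  have hAb : 0 ≤ A * b := mul_nonneg hA hb
  have hu0 : 0 < u := by linarith
  have hv0 : 0 < v := by rw [hv]; linarith
  -- clear denominators: both sides times 2 u² v³ > 0
  rw [div_pow, ← sub_nonneg]
  have key : A ^ 2 / (2 * u ^ 2) - A ^ 2 / (2 * v ^ 2) - b * (A ^ 3 / v ^ 3)
      = (A ^ 2 * (v ^ 3 - u ^ 2 * v) - 2 * b * A ^ 3 * u ^ 2) / (2 * u ^ 2 * v ^ 3) := by
    field_simp
    try ring
  have num : A ^ 2 * (v ^ 3 - u ^ 2 * v) - 2 * b * A ^ 3 * u ^ 2 = A ^ 2 * ((v - u) ^ 2 * (v + 2 * u)) := by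
    have : A * b = v - u := by rw [hv]; ring
    calc A ^ 2 * (v ^ 3 - u ^ 2 * v) - 2 * b * A ^ 3 * u ^ 2
        = A ^ 2 * (v ^ 3 - u ^ 2 * v - 2 * (A * b) * u ^ 2) := by ring
      _ = A ^ 2 * (v ^ 3 - u ^ 2 * v - 2 * (v - u) * u ^ 2) := by rw [this]
      _ = A ^ 2 * ((v - u) ^ 2 * (v + 2 * u)) := by ring
  rw [key, num]
  apply div_nonneg
  · exact mul_nonneg (sq_nonneg _) (mul_nonneg (sq_nonneg _) (by linarith))
  · positivity

/-- **Cubic tails against the envelope after the step telescope exactly:** for `b_k ≥ 0`, `A ≥ 0`, `B_k = Σ_{j<k} b_j`,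
`Σ_{k<N} b_k (A/(1 + A B_{k+1}))³ ≤ A²/2 − A²/(2(1 + A B_N)²)`. -/
theorem sum_mul_repulsiveEnvelope_succ_cube_le_sub {b : ℕ → ℝ} (hb : ∀ k, 0 ≤ b k) {A : ℝ} (hA : 0 ≤ A) (N : ℕ) :
    ∑ k ∈ range N, b k * (A / (1 + A * ∑ j ∈ range (k + 1), b j)) ^ 3
      ≤ A ^ 2 / 2 - A ^ 2 / (2 * (1 + A * ∑ j ∈ range N, b j) ^ 2) := by
  induction N with
  | zero => simp
  | succ N ih =>
    rw [sum_range_succ]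
    have hB : 0 ≤ ∑ j ∈ range N, b j := sum_nonneg fun j _ => hb j
    have hstep := step_telescope (u := 1 + A * ∑ j ∈ range N, b j) (v := 1 + A * ∑ j ∈ range (N + 1), b j)
      hA (hb N) (by nlinarith [mul_nonneg hA hB]) (by rw [sum_range_succ]; ring)
    linarith

/-- **Cubic tails of a repulsive block are `O(A²)`** (envelope after the step): `Σ_{k<N} b_k (A/(1 + A B_{k+1}))³ ≤ A²/2`. -/
theorem sum_mul_repulsiveEnvelope_succ_cube_le {b : ℕ → ℝ} (hb : ∀ k, 0 ≤ b k) {A : ℝ} (hA : 0 ≤ A) (N : ℕ) :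
    ∑ k ∈ range N, b k * (repulsiveEnvelope A (∑ j ∈ range (k + 1), b j)) ^ 3 ≤ A ^ 2 / 2 := by
  have h := sum_mul_repulsiveEnvelope_succ_cube_le_sub hb hA N
  have hB : 0 ≤ ∑ j ∈ range N, b j := sum_nonneg fun j _ => hb j
  have : 0 ≤ A ^ 2 / (2 * (1 + A * ∑ j ∈ range N, b j) ^ 2) := by positivity
  simp only [repulsiveEnvelope]
  linarith

/-- One cascade step changes the repulsive envelope by at most the factor `1 + A b`:
`A/(1 + A B) ≤ (1 + A b) · A/(1 + A (B + b))` for `A, b, B ≥ 0`. -/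
theorem repulsiveEnvelope_le_mul_succ {A b B : ℝ} (hA : 0 ≤ A) (hb : 0 ≤ b) (hB : 0 ≤ B) :
    A / (1 + A * B) ≤ (1 + A * b) * (A / (1 + A * (B + b))) := by
  have hAB : 0 ≤ A * B := mul_nonneg hA hB
  have hAb : 0 ≤ A * b := mul_nonneg hA hb
  have h1 : 0 < 1 + A * B := by linarith
  have h2 : 0 < 1 + A * (B + b) := by nlinarith
  rw [div_le_iff₀ h1]
  have e : (1 + A * b) * (A / (1 + A * (B + b))) * (1 + A * B)
      = A * ((1 + A * b) * (1 + A * B) / (1 + A * (B + b))) := by ring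
  rw [e]
  refine le_mul_of_one_le_right hA ?_
  rw [le_div_iff₀ h2]
  nlinarith [mul_nonneg hAb hAB]

/-- **Cubic tails of a repulsive block are `O(A²)`** (envelope before the step): if `b_k ≥ 0`, `A ≥ 0` and `A b_k ≤ β` for all `k`,
then `Σ_{k<N} b_k (A/(1 + A B_k))³ ≤ (1 + β)³ A²/2`, `B_k = Σ_{j<k} b_j` — uniformly in `N`.  (In the programme: `A = V₀^Γ ≍ U`,
`b_k ≤ b_max = O(1)`, so `β ≍ U` and the cubic cascade tails of every repulsive `D₄` block total `≤ const · U²`.) -/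
theorem sum_mul_repulsiveEnvelope_cube_le {b : ℕ → ℝ} (hb : ∀ k, 0 ≤ b k) {A β : ℝ} (hA : 0 ≤ A)
    (hβ : ∀ k, A * b k ≤ β) (N : ℕ) :
    ∑ k ∈ range N, b k * (repulsiveEnvelope A (∑ j ∈ range k, b j)) ^ 3 ≤ (1 + β) ^ 3 * (A ^ 2 / 2) := by
  have hβ0 : 0 ≤ β := le_trans (mul_nonneg hA (hb 0)) (hβ 0)
  calc ∑ k ∈ range N, b k * (repulsiveEnvelope A (∑ j ∈ range k, b j)) ^ 3
      ≤ ∑ k ∈ range N, b k * ((1 + β) * repulsiveEnvelope A (∑ j ∈ range (k + 1), b j)) ^ 3 := by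
        apply sum_le_sum
        intro k _
        have hB : 0 ≤ ∑ j ∈ range k, b j := sum_nonneg fun j _ => hb j
        have hpos : 0 ≤ A / (1 + A * (∑ j ∈ range k, b j + b k)) := by
          apply div_nonneg hA; nlinarith [mul_nonneg hA hB, mul_nonneg hA (hb k)]
        have hle : repulsiveEnvelope A (∑ j ∈ range k, b j)
            ≤ (1 + β) * repulsiveEnvelope A (∑ j ∈ range (k + 1), b j) := by
          simp only [repulsiveEnvelope]
          rw [sum_range_succ]
          calc A / (1 + A * ∑ j ∈ range k, b j)
              ≤ (1 + A * b k) * (A / (1 + A * (∑ j ∈ range k, b j + b k))) :=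
                repulsiveEnvelope_le_mul_succ hA (hb k) hB
            _ ≤ (1 + β) * (A / (1 + A * (∑ j ∈ range k, b j + b k))) :=
                mul_le_mul_of_nonneg_right (by linarith [hβ k]) hpos
        have h0 : 0 ≤ repulsiveEnvelope A (∑ j ∈ range k, b j) := by
          simp only [repulsiveEnvelope]; apply div_nonneg hA; nlinarith [mul_nonneg hA hB]
        exact mul_le_mul_of_nonneg_left (pow_le_pow_left₀ h0 hle 3) (hb k)
    _ = (1 + β) ^ 3 * ∑ k ∈ range N, b k * (repulsiveEnvelope A (∑ j ∈ range (k + 1), b j)) ^ 3 := by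
        rw [mul_sum]; refine sum_congr rfl fun k _ => ?_; ring
    _ ≤ (1 + β) ^ 3 * (A ^ 2 / 2) :=
        mul_le_mul_of_nonneg_left (sum_mul_repulsiveEnvelope_succ_cube_le hb hA N) (by positivity)

end Summit.HubbardSuperconductivity.HubbardSuperconductivity.Theorems.CooperChannelCubicTail

end
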